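import Summits.QuantumFields.YangMills.Theorems.AlphaInputsT3ACv3LocalSmall
import Summits.QuantumFields.YangMills.Theorems.BalabanUVNodesN21LocalAveragedRegularityLevels
import Literature.MathematicalPhysics.QuantumFieldTheory.Balaban1983to89.BlockAveragingPlaquetteBoundLocal
import HarnessLib

/-!
# `AlphaInputsT3ACv3LocalSmallBoxes` — STRATEGY B for 2′: MEMBERSHIP IN THE LOCALISED SMALL-LOOP CLASS FROM FINE-PLAQUETTE SMALLNESS ON EXPLICIT BOXES
# (the (D6L) plumbing: [Balaban1985Averaging] Props. 1–2 for the (0.4) averaging of record, LOCAL, by name) — lane `pub-balaban3d`, seat alpha-2 (g2)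

WHAT.  For the averaging of record `blockAvg expMeanLogSU` on `SU(N)`: a configuration `U` of the finest lattice lies in `LocalSmallLoop.NestedSmallOn expMeanLogSU δ′ E k`
(sibling `AlphaInputsT3ACv3LocalSmall`) as soon as, for every level `i < k` and every bond `c ∈ E (i+1)`, its FINE plaquettes are `α₀·L^{−2i}`-small on the fine box of
radius `L^i·(2L + (d+4)L + 2)` around the bottom of the chain of block centres below `emb c₋` — with `α₀` in [B7] Prop. 2's window and
`(((d+2)L)²/4)·(α₀ + 2C₀(d)α₀²) ≤ δ′`.  Chain: local Prop. 2 (`…N21LocalAveragedRegularityLevels.plaqSmallOn_iter_blockAvg_eml_loc_pow`: the `i`-fold average is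
`(α₀ + 2C₀α₀²)`-small on `boxRegion (emb c₋) 2L`) ⊇ the plaquettes based in the three blocks `B(c₋ − e_μ) ∪ B(c₋) ∪ B(c₊)` (§1, torus labels in the standing range)
⇒ local Prop. 1 for the loop variables (`BlockAveragingPlaquetteBoundLocal.dist1_loopHol_le_local`).
WHY.  This is the form in which the displayed non-emptiness (D6L) of the localised adapted class (`AlphaInputsT3ACv3DataSchemaL`) is to be discharged for a
profile: the profile's job is reduced to FINE-plaquette bounds on explicit boxes around the dependency cones of the read bonds (HOME `D6-AUDIT-alpha2-g2.md` §4).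
HONEST FRAMING.  Plumbing of tree theorems; no new estimate; count-neutral helper toward R3 2′ (`stub_laneRecordsV3`, items 19935∕19936); nothing about d = 4, the
continuum, or a mass gap.

References: T. Bałaban, Commun. Math. Phys. 98 (1985) 17–51 [Balaban1985Averaging] (Props. 1–2 (51)–(54) p.26); CMP 109 (1987) 249–301 [Balaban1987RG1] ((0.1)–(0.4) pp.251–253).
-/

set_option autoImplicit false

noncomputable section

namespace Summit.QuantumFields.YangMills.Theorems.LocalSmallLoop

open Set
open Literature.MathematicalPhysics.QuantumFieldTheory.Balaban1983to89
open Literature.MathematicalPhysics.QuantumFieldTheory.Balaban1983to89.ExpMeanLog (expMeanLogSU deltaSU)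
open Literature.MathematicalPhysics.QuantumFieldTheory.Balaban1983to89.BlockAveraging (blockAvg loopHol Idx)
open Literature.MathematicalPhysics.QuantumFieldTheory.Balaban1983to89.BlockAveragingPlaquetteBoundLocal (dist1_loopHol_le_local)
open Summit.QuantumFields.YangMills.BalabanUVNodes.N20LCSAvgDominationRegion (boxRegion mem_boxRegion)
open Summit.QuantumFields.YangMills.Theorems.N21LocalAveragedRegularity (exists_embChain plaqSmallOn_iter_blockAvg_eml_loc_pow)

variable {P : Params}

/-! ## §1 Torus labels: the three blocks around a coarse bond lie in the box of radius `2L` around the centre of `B(c₋)` -/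

/-- A fine site of the block `B(y)` is within `L` of the block centre `emb y` in every coordinate (labels `nL + r`, `0 ≤ r < L`, versus `nL + (L−1)/2`; standing range).
[cite: Balaban1987RG1, (0.1) p.252] -/
theorem exists_offset_of_blockOf_eq {j : ℕ} (hj : j + 1 ≤ P.m + P.K) {s : Site P j} {y : Site P (j + 1)} (h : blockOf s = y) (ν : Fin P.d) :
    ∃ e : ℤ, |e| ≤ (P.L : ℤ) ∧ s ν = (emb y) ν + (e : ZMod (P.sitesPerDir j)) := by
  have hv : (s ν).val / P.L = (y ν).val := by rw [← Site.val_blockOf hj s ν, h]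
  set r : ℕ := (s ν).val % P.L with hr_def
  have hr : r < P.L := Nat.mod_lt _ P.L_pos
  have hdm : P.L * (y ν).val + r = (s ν).val := by rw [hr_def, ← hv]; exact Nat.div_add_mod _ _
  set c : ℕ := (P.L - 1) / 2 with hc_def
  have hh : c < P.L := by have := P.hL.2; omega
  refine ⟨(r : ℤ) - (c : ℤ), ?_, ?_⟩
  · rw [abs_le]; constructor <;> omega
  · have h1 : s ν = (((s ν).val : ℕ) : ZMod (P.sitesPerDir j)) := (ZMod.natCast_zmod_val _).symm
    have h2 : emb y ν = (((emb y ν).val : ℕ) : ZMod (P.sitesPerDir j)) := (ZMod.natCast_zmod_val _).symm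
    have h3 : ((emb y) ν).val = (y ν).val * P.L + c := by rw [hc_def]; exact Site.val_emb hj y ν
    rw [h1, h2, h3, ← hdm]
    push_cast
    ring

/-- **THE THREE BLOCKS AROUND A COARSE BOND LIE IN THE BOX OF RADIUS `2L` AROUND `emb c₋`**: a fine site whose block is `c₋ − e_μ`, `c₋` or `c₊ = c₋ + e_μ` is within
`2L` of `emb c₋` in every coordinate (`emb (y ± e_μ) = emb y ± L e_μ`, `T4Continuum.emb_shift_apply`). [cite: Balaban1987RG1, (0.1)+(0.3) pp.251–252] -/
theorem exists_offset_of_blockOf_near {j : ℕ} (hj : j + 1 ≤ P.m + P.K) {y : Site P (j + 1)} {μ : Fin P.d} {s : Site P j}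
    (hs : blockOf s = y.unshift μ ∨ blockOf s = y ∨ blockOf s = y.shift μ) (ν : Fin P.d) :
    ∃ e : ℤ, |e| ≤ ((2 * P.L : ℕ) : ℤ) ∧ s ν = (emb y) ν + (e : ZMod (P.sitesPerDir j)) := by
  rcases hs with h | h | h
  · obtain ⟨e, he, hse⟩ := exists_offset_of_blockOf_eq hj h ν
    have hsh := T4Continuum.emb_shift_apply (y.unshift μ) μ ν
    rw [B10StarCount.shift_unshift] at hsh
    refine ⟨e - (if ν = μ then (P.L : ℤ) else 0), ?_, ?_⟩
    · rw [abs_le] at he ⊢; split_ifs <;> push_cast <;> constructor <;> linarith [he.1, he.2]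
    · rw [hse, eq_sub_of_add_eq hsh.symm]
      split_ifs <;> push_cast <;> ring
  · obtain ⟨e, he, hse⟩ := exists_offset_of_blockOf_eq hj h ν
    exact ⟨e, he.trans (by push_cast; linarith [show (0 : ℤ) ≤ P.L from Int.natCast_nonneg _]), hse⟩
  · obtain ⟨e, he, hse⟩ := exists_offset_of_blockOf_eq hj h ν
    have hsh := T4Continuum.emb_shift_apply y μ ν
    refine ⟨e + (if ν = μ then (P.L : ℤ) else 0), ?_, ?_⟩
    · rw [abs_le] at he ⊢; split_ifs <;> push_cast <;> constructor <;> linarith [he.1, he.2]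
    · rw [hse, hsh]
      split_ifs <;> push_cast <;> ring

/-- The plaquettes based in the three blocks around a coarse bond `c` lie in `boxRegion (emb c₋) (2L)`. [cite: Balaban1987RG1, (0.3) p.252] -/
theorem mem_boxRegion_of_blockOf_near {j : ℕ} (hj : j + 1 ≤ P.m + P.K) (c : PBond P (j + 1)) {q : Plaq P j}
    (hq : blockOf q.src = c.src.unshift c.dir ∨ blockOf q.src = c.src ∨ blockOf q.src = c.tgt) : q ∈ boxRegion (emb c.src) (2 * P.L) :=
  mem_boxRegion.mpr (exists_offset_of_blockOf_near hj hq)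

/-! ## §2 Membership in the localised class from fine-plaquette smallness on the boxes -/

/-- **★ MEMBERSHIP IN `NestedSmallOn expMeanLogSU δ′ E k` FROM FINE-PLAQUETTE SMALLNESS ON EXPLICIT BOXES.**  If for every `i < k` and `c ∈ E (i+1)` the fine
plaquettes of `U` are `α₀·(L^i)⁻²`-small on `boxRegion (xs 0) (L^i·(2L + (d+4)L + 2))` for the chain of block centres `xs` below `emb c₋` (`xs i = emb c₋`,
`xs l = emb (xs (l+1))`), with `0 < α₀`, `C₀(d)α₀ ≤ ⅓`, `2α₀ ≤ c′₂(d, L, N)` and `(((d+2)L)²/4)·(α₀ + 2C₀(d)α₀²) ≤ δ′` (`C₀(d) = 143((d+4)²/4)²`), then every (0.4) loop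
variable of `(blockAvg expMeanLogSU)^i U` at `c` is within `δ′` of `1` — local Prop. 2 on the box of radius `2L` around `emb c₋` (which contains the three blocks the loops
visit), then local Prop. 1 for the loop words. [cite: Balaban1985Averaging, Prop. 2 (52)–(54) p.26 + Prop. 1 (51) p.26] -/
theorem nestedSmallOn_of_plaqSmallOn_boxes {n : Type*} [Fintype n] [DecidableEq n] [Nonempty n]
    {E : (i : ℕ) → Set (PBond P i)} {k : ℕ} (hk : k ≤ P.m + P.K) {α₀ δ' : ℝ} (hα : 0 < α₀)
    (hα3 : (143 * ((((P.d + 4 : ℕ) : ℝ)) ^ 2 / 4) ^ 2) * α₀ ≤ 1 / 3)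
    (hα2 : 2 * α₀ ≤ 2 * deltaSU n / (((P.d + 4) * P.L : ℕ) : ℝ) ^ 2)
    (hδ' : ((((P.d + 2) * P.L : ℕ) : ℝ) ^ 2 / 4) * (α₀ + 2 * (143 * ((((P.d + 4 : ℕ) : ℝ)) ^ 2 / 4) ^ 2) * α₀ ^ 2) ≤ δ')
    {U : GaugeField P 0 (Matrix.specialUnitaryGroup n ℂ)}
    (h : ∀ i, i < k → ∀ c ∈ E (i + 1), ∀ xs : (l : ℕ) → Site P l, xs i = emb c.src → (∀ l, l < i → xs l = emb (xs (l + 1))) →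
      PlaqSmallOn (↑(boxRegion (xs 0) (P.L ^ i * (2 * P.L + ((P.d + 4) * P.L + 2)))) : Set (Plaq P 0)) (α₀ * (((P.L : ℝ) ^ i)⁻¹) ^ 2) U) :
    U ∈ NestedSmallOn (expMeanLogSU (n := n)) δ' E k := by
  intro i hi c hc x
  obtain ⟨xs, hxi, hxs⟩ := exists_embChain (P := P) i (emb c.src)
  have h54 := plaqSmallOn_iter_blockAvg_eml_loc_pow (n := n) i hα hα3 hα2 xs hxs (2 * P.L) (h i hi c hc xs hxi hxs)
  have hC : (0 : ℝ) ≤ 143 * ((((P.d + 4 : ℕ) : ℝ)) ^ 2 / 4) ^ 2 := by positivity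
  have hδ0 : 0 ≤ α₀ + 2 * (143 * ((((P.d + 4 : ℕ) : ℝ)) ^ 2 / 4) ^ 2) * α₀ ^ 2 := by positivity
  have hi' : i + 1 ≤ P.m + P.K := Nat.succ_le_of_lt (lt_of_lt_of_le hi hk)
  have hloc := dist1_loopHol_le_local (P := P) hδ0 hi' (U := Averaging.iter (fun _ => blockAvg (expMeanLogSU (n := n))) i U) c
    (fun q hq => h54 q (Finset.mem_coe.mpr (by rw [hxi]; exact mem_boxRegion_of_blockOf_near hi' c hq))) x
  exact hloc.trans hδ'

end Summit.QuantumFields.YangMills.Theorems.LocalSmallLoop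

end
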